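import Summits.QuantumFields.YangMills.Theorems.BalabanUVNodesN06HstarJAtPinsWPhys
import Summits.QuantumFields.YangMills.Theorems.BalabanUVNodesN06Delta2AtPinsC2PhysR

/-!
# BalabanUVNodes ∕ N06 ([B9], `Dag.B9_main`) — THE `(H\*J)` LETTER AND ED.30's `hD2sup` ∕ ED.29's `hD2L2` FROM THE WEIGHTED TRANSPOSE LETTER, AT def-Y's
# CLASS-PARAMETRIC CARRIER `bg9YR 𝔸 G R₁ R₂` (CASCADE-R ∕ STEP-3 faces of `…N06HstarJAtPinsWPhys`)

Track A of `YM-PLAN.md` (cell `pub-ymgap`, HUMAN RULING D-0062), node **N06** = [Balaban1985BackgroundPropagators] Thms 3.1–3.15; seat `pub-ymgap-dag-n06-w8` (g3), 2026-08-28.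
WHY.  See `…N06Delta2AtPinsC2PhysR` (module docstring): after node00-def-Y's RULING-W′ ∕ dag-n06-d's STEP-3 form (α) the certificate's regime binders read print's class;
this file re-types `…N06HstarJAtPinsWPhys` ONCE at def-Y's class-parametric carrier: premises `(bg9YR (M_N(ℂ)) SU(N) R₁ R₂ x).Reg335 c α₀ U` (`= R₁ x c α₀ U`), `c` FREE,
objects UNCHANGED (`𝔗 x U`, `HcoK … (bg9Y … x) …`, `U : (bg9Y …).Cfg`, the pins `hbI0 ∕ hblk12`); the regularity letter `hreg` stays a DISPLAYED binder here (generic `R₂`)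
— at print's class `R₂ := regYP336` it is a THEOREM (`B9Eq336RegularAtAllBondsP.regularAt_pinScale_of_regYP336`, this seat's F12; discharged in `…N06HTransposeAtPinsPhysR`).
★★ `hHJ_of_transpose_schemas_wR` (no class fact read), ★★ `hD2sup_of_transpose_schemas_wR`, ★★ `hD2L2_of_transpose_schemas_wR` (class axiom `hG : MemOfFam SU(N) R₁`
for def-Y's reality letters) — proofs VERBATIM those of the originals; `bg9Y` (`c := c35Y`) and `bg9YP` specialise by `rfl`.
HONEST FRAMING.  Kernel bookkeeping ((3.136) transposition + [4] (2.51)∕(2.54)∕(2.60)∕(2.61) over r06's (3.36) theorem and def-Y's dictionary BY NAME); COUNT-NEUTRAL;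
nothing of [B9]∕[5] asserted — [5] (149) (`hC2`), the transpose letter (`hHT`) and the cube covering (`hreg`) stay DISPLAYED; N06 NOT discharged; K1 NOT closed.  One finite
𝕋⁴ programme at fixed `ε` — NOT continuum, NOT OS, NOT the mass gap ∕ Clay.  0 `def`, 0 `sorry`.
-/

noncomputable section

namespace Summit.QuantumFields.YangMills.BalabanUVNodes.N06HstarJAtPinsWPhysR

open Literature.MathematicalPhysics.QuantumFieldTheory.Balaban1983to89
open Literature.MathematicalPhysics.QuantumFieldTheory.Balaban1983to89.Node00 (CfgY FBondY IBondY GpY parSymY parBY trDualMatY trAdjY JY Stage3Params C2Y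
  resYOfC2 etaBY etaS deltaY)
open Literature.MathematicalPhysics.QuantumFieldTheory.Balaban1983to89.B9Eq3132SectDLetters (HDY)
open Literature.MathematicalPhysics.QuantumFieldTheory.Balaban1983to89.B9Thm34Ext (toB6)
open Literature.MathematicalPhysics.QuantumFieldTheory.Balaban1983to89.B6RandomWalk (HasMajorant)
open Literature.MathematicalPhysics.QuantumFieldTheory.Balaban1983to89.B6RandomWalkHom (HasMajorantHom)
open Literature.MathematicalPhysics.QuantumFieldTheory.Balaban1983to89.B9SectDL2Decay (BlockBd)
open Literature.MathematicalPhysics.QuantumFieldTheory.Balaban1983to89.B9Thm37Glue (IsTransposePair)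
open Literature.MathematicalPhysics.QuantumFieldTheory.Balaban1983to89.B9Thm312Whole (GeoOK)
open Literature.MathematicalPhysics.QuantumFieldTheory.Balaban1983to89.B9RWSums343to347Whole (Facts347)
open Literature.MathematicalPhysics.QuantumFieldTheory.Balaban1983to89.B9RWSumsDefinitePins (PinPrims)
open Literature.MathematicalPhysics.QuantumFieldTheory.Balaban1983to89.B9RWSums347DefiniteFaces (exp261 lemma21Pack_geo9Y)
open Literature.MathematicalPhysics.QuantumFieldTheory.Balaban1983to89.B9RowSum261DefiniteFaces (rowConst261 rowConst261_nonneg rowConst261_spec_of_rowSum261)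
open Literature.MathematicalPhysics.QuantumFieldTheory.Balaban1983to89.B9RWSums346Schur (scaleTransfer_len_rpow)
open Literature.MathematicalPhysics.QuantumFieldTheory.Balaban1983to89.B9PinMembersKLevelV1 (MemberY geo9Y bg9Y)
open Literature.MathematicalPhysics.QuantumFieldTheory.Balaban1983to89.B9GeoLemma21KLevelV1 (geo9Y_len_pos geo9Y_dist_triangle geo9Y_dist_comm rowSum261_geo9Y)
open Literature.MathematicalPhysics.QuantumFieldTheory.Balaban1983to89.B9GeoNormsKLevelV1 (geo9K_dist_nonneg)
open Literature.MathematicalPhysics.QuantumFieldTheory.Balaban1983to89.B7Prop2SpecialUnitary (specialUnitaryUnits specialUnitaryUnits_le_unitaryUnits)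
open Literature.MathematicalPhysics.QuantumFieldTheory.Balaban1983to89.B9CoReadingCoords (XBK blkBK)
open Literature.MathematicalPhysics.QuantumFieldTheory.Balaban1983to89.B9CoReadingCoordsH (XHK HcoK)
open Literature.MathematicalPhysics.QuantumFieldTheory.Balaban1983to89.B9CoReadingCoordsS (XSK)
open Literature.MathematicalPhysics.QuantumFieldTheory.Balaban1983to89.B9CoReadingCoordsTranspose (TrIdx trBasis)
open Literature.MathematicalPhysics.QuantumFieldTheory.Balaban1983to89.B9Thm39ReadingCoords (cR39 basisBound39 coordBound39)
open Literature.MathematicalPhysics.QuantumFieldTheory.Balaban1983to89.Node00.OpsYSectDCoords (cR39_trBasis_pos)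
open Literature.MathematicalPhysics.QuantumFieldTheory.Balaban1983to89.B9PerturbationL2Delta2 (D2coK)
open Literature.MathematicalPhysics.QuantumFieldTheory.Balaban1983to89.B9Delta2FormMajorant (C2FormMaj)
open Literature.MathematicalPhysics.QuantumFieldTheory.Balaban1983to89.B9Eq336CurrentBound (RegularAt)
open Literature.MathematicalPhysics.QuantumFieldTheory.Balaban1983to89.B9BackgroundsKLevelV1 (shiftsV1)
open Literature.MathematicalPhysics.QuantumFieldTheory.Balaban1983to89.B6GlobalChartV1 (PV)
open Literature.MathematicalPhysics.QuantumFieldTheory.Balaban1983to89.B6Ineq2142KLevelV1 (β)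
open Literature.MathematicalPhysics.QuantumFieldTheory.Balaban1983to89.B9Ineq349SiteComposite (lenB lenB_eq etaS_pos)
open Literature.MathematicalPhysics.QuantumFieldTheory.Balaban1983to89.B9Ineq349SiteFromBlocks (geo9Y_len_eq_lenB etaS_eq_abs_cf_inv)
open Literature.MathematicalPhysics.QuantumFieldTheory.Balaban1983to89.B9Eq3136HstarJBound (norm_trAdjY_JY_le_of_transposePair_regularAt
  norm_trAdjY_JY_le_of_cols_regularAt sum_fiber_kernel_le_of_transposePair colConst_eq norm_apply_deltaY_le_sum_basis)
open Summit.QuantumFields.YangMills.BalabanUVNodes.N06Delta2AtPinsC2PhysR (hD2sup_of_form_schemas_wR hD2L2_of_form_schemas_wR)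
open Literature.MathematicalPhysics.QuantumFieldTheory.Balaban1983to89.B9BackgroundsKLevelV1R (RegFamY bg9YR MemOfFam)
open Summit.QuantumFields.YangMills.BalabanUVNodes.N06HstarJAtPinsPhys (etaBY_le_len)
open scoped Matrix.Norms.L2Operator

variable {N : ℕ} [NeZero N] {θ : Stage3Params} {Mstar : ℕ}
variable [∀ x : MemberY θ.d₆ θ.ℓ₆ θ.hd' θ.hL' θ.b₀ θ.b₁ Mstar, Fintype (geo9Y x).Site]
/-! ## The WEIGHTED transpose letter — the member-uniformly inhabitable form (`W_T = n_c` at the record; `…N06HstarJAtPinsPhys` = `W_T ≡ 1`) -/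

/-- ★★ **F6's `(H\*J)` LETTER `hHJ` AT THE PINS FROM THE WEIGHTED TRANSPOSE-MAJORANT LETTER** — `hHJ_of_transpose_schemas` with a free weight family
`W_T x c ≧ 0` at the coarse end of `hHT`'s majorant (`B_T·W_T(c)·e^{−δ_T d}`; at the record `W_T = n_c`, the block count — the member-uniformly inhabitable form);
output at `w_H x c := W_T x c·((Lʲη)_c³)⁻¹`.  Original docstring of the `W_T ≡ 1` form:
in the regime and above ONE threshold, `‖(H(U)†J(U))(c)‖ ≦ t_{HJ}·(M_xα₀)·((Lʲη)_c³)⁻¹` for def-Y's `H(U) = HDY x.toKIdx parSymY parBY (GpY parSymY) U` and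
`J(U) = JY x.toKIdx U` — F6's binder `hHJ` VERBATIM at the weight family `w_H x c := ((geo9Y x).len c ^ 3)⁻¹`.
[cite: Balaban1985BackgroundPropagators, p.422 (the sentence between (3.136) and (3.137)), (3.133) p.422, (3.36) p.396, (3.126) p.420, p.398; Balaban1984PropagatorsII, (2.51) p.232, Lemma 2.1 (2.60)–(2.61) pp.233–234] -/
theorem hHJ_of_transpose_schemas_wR (q : PinPrims) (hq : q.OK) (H : MemberY θ.d₆ θ.ℓ₆ θ.hd' θ.hL' θ.b₀ θ.b₁ Mstar → Prop)
    (R₁ R₂ : RegFamY θ.d₆ θ.ℓ₆ θ.hd' θ.hL' θ.b₀ θ.b₁ Mstar (Matrix (Fin N) (Fin N) ℂ)) (c : ℝ)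
    (bI : ∀ x : MemberY θ.d₆ θ.ℓ₆ θ.hd' θ.hL' θ.b₀ θ.b₁ Mstar, FBondY x.toKIdx → IBondY x.toKIdx)
    (hbI0 : ∀ (x : MemberY θ.d₆ θ.ℓ₆ θ.hd' θ.hL' θ.b₀ θ.b₁ Mstar) (f : FBondY x.toKIdx), bI x f = bI x ⟨f.src, 0⟩)
    (𝔗 : ∀ x : MemberY θ.d₆ θ.ℓ₆ θ.hd' θ.hL' θ.b₀ θ.b₁ Mstar, (bg9Y (Matrix (Fin N) (Fin N) ℂ) (specialUnitaryUnits (Fin N)) x).Cfg →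
      (XBK (TrIdx N) x.toKIdx → ℝ) →ₗ[ℝ] (XHK (TrIdx N) x.toKIdx → ℝ))
    (WT : ∀ x : MemberY θ.d₆ θ.ℓ₆ θ.hd' θ.hL' θ.b₀ θ.b₁ Mstar, IBondY x.toKIdx → ℝ) (hWT : ∀ x c, 0 ≤ WT x c)
    (cJ BT δT ρR tHJ M a : ℝ) (hcJ : 0 ≤ cJ) (hBT : 0 ≤ BT) (hρR : 0 < ρR) (hM : 0 < M) (ha1 : cJ * a ≤ 1)
    (hδT : q.αF * ((1 - 2 * q.α) * q.δ₀) + ρR ≤ δT)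
    (htHJ : N * basisBound39 (trBasis N) ^ 2 * (10 ^ 4 * ((θ.d₆ : ℝ) + 1) * cJ) * (((θ.d₆ : ℝ) + 1) * Fintype.card (TrIdx N) * BT) *
      ((((θ.ℓ₆ + 1 : ℕ) : ℝ) ^ 3) * rowConst261 (geo9Y (d := θ.d₆) (ℓ := θ.ℓ₆) (hd := θ.hd') (hL := θ.hL') (b₀ := θ.b₀) (b₁ := θ.b₁) (Mstar := Mstar)) ρR) ≤ tHJ)
    (hHT : ∀ x : MemberY θ.d₆ θ.ℓ₆ θ.hd' θ.hL' θ.b₀ θ.b₁ Mstar, M ≤ (geo9Y x).M → ∀ α₀ : ℝ, 0 < α₀ → (geo9Y x).M * α₀ ≤ a →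
      ∀ U : (bg9Y (Matrix (Fin N) (Fin N) ℂ) (specialUnitaryUnits (Fin N)) x).Cfg,
        (bg9YR (Matrix (Fin N) (Fin N) ℂ) (specialUnitaryUnits (Fin N)) R₁ R₂ x).Reg335 c α₀ U →
        (bg9YR (Matrix (Fin N) (Fin N) ℂ) (specialUnitaryUnits (Fin N)) R₁ R₂ x).Reg336 c α₀ U →
          IsTransposePair (HcoK x.toKIdx (trBasis N) (bg9Y (Matrix (Fin N) (Fin N) ℂ) (specialUnitaryUnits (Fin N)) x) (fun U => U)
              (HDY x.toKIdx (parSymY x.toKIdx) (parBY x.toKIdx) (GpY x.toKIdx (parSymY x.toKIdx))) U) (𝔗 x U) ∧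
            HasMajorantHom (g := toB6 (geo9Y x) 1 (H x)) (fun p : XBK (TrIdx N) x.toKIdx => bI x p.1) (fun p : XHK (TrIdx N) x.toKIdx => p.1) (𝔗 x U)
              (fun c y' => BT * WT x c * Real.exp (-(δT * (geo9Y x).dist c y'))))
    (hreg : ∀ x : MemberY θ.d₆ θ.ℓ₆ θ.hd' θ.hL' θ.b₀ θ.b₁ Mstar, M ≤ (geo9Y x).M → ∀ α₀ : ℝ, 0 < α₀ → (geo9Y x).M * α₀ ≤ a →
      ∀ U : (bg9Y (Matrix (Fin N) (Fin N) ℂ) (specialUnitaryUnits (Fin N)) x).Cfg,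
        (bg9YR (Matrix (Fin N) (Fin N) ℂ) (specialUnitaryUnits (Fin N)) R₁ R₂ x).Reg335 c α₀ U →
        (bg9YR (Matrix (Fin N) (Fin N) ℂ) (specialUnitaryUnits (Fin N)) R₁ R₂ x).Reg336 c α₀ U →
          ∀ μ s, RegularAt (shiftsV1 (PV θ.d₆ θ.ℓ₆ x.toKIdx.m x.toKIdx.K θ.hd' θ.hL')) U (etaBY x.toKIdx)
            (cJ * ((geo9Y x).M * α₀)) ((geo9Y x).len (bI x ⟨s, 0⟩)) μ s) :
    ∃ MH : ℝ, ∀ x : MemberY θ.d₆ θ.ℓ₆ θ.hd' θ.hL' θ.b₀ θ.b₁ Mstar, MH ≤ (geo9Y x).M → M ≤ (geo9Y x).M → ∀ α₀ : ℝ, 0 < α₀ → (geo9Y x).M * α₀ ≤ a →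
      ∀ U : (bg9Y (Matrix (Fin N) (Fin N) ℂ) (specialUnitaryUnits (Fin N)) x).Cfg,
        (bg9YR (Matrix (Fin N) (Fin N) ℂ) (specialUnitaryUnits (Fin N)) R₁ R₂ x).Reg335 c α₀ U →
        (bg9YR (Matrix (Fin N) (Fin N) ℂ) (specialUnitaryUnits (Fin N)) R₁ R₂ x).Reg336 c α₀ U →
          ∀ c : IBondY x.toKIdx,
            ‖trAdjY (trDualMatY N) (HDY x.toKIdx (parSymY x.toKIdx) (parBY x.toKIdx) (GpY x.toKIdx (parSymY x.toKIdx)) U) (JY x.toKIdx U) c‖ ≤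
              tHJ * ((geo9Y x).M * α₀) * (WT x c * ((geo9Y x).len c ^ 3)⁻¹) := by
  -- member facts: the p. 398 transfer at ((1 − 2α)δ₀, α_F) and [4] (2.61) at the rate ρ_R, above ONE threshold each
  obtain ⟨Mth, -, hfacts, -⟩ :=
    lemma21Pack_geo9Y (d := θ.d₆) (ℓ := θ.ℓ₆) (hd := θ.hd') (hL := θ.hL') (b₀ := θ.b₀) (b₁ := θ.b₁) (Mstar := Mstar) H hq.α_pos hq.α_lt
      hq.δ₀_pos hq.αF_pos (by linarith only [hq.αF_lt])
  obtain ⟨MLσ, hrowc⟩ := rowConst261_spec_of_rowSum261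
    (rowSum261_geo9Y (d := θ.d₆) (ℓ := θ.ℓ₆) (hd := θ.hd') (hL := θ.hL') (b₀ := θ.b₀) (b₁ := θ.b₁) (Mstar := Mstar)) hρR
  have hN : 0 < N := Nat.pos_of_ne_zero (NeZero.ne N)
  have hc0 : 0 < cR39 (trBasis N) := cR39_trBasis_pos hN
  refine ⟨max Mth MLσ, fun x hMx hMM α₀ hα ha U hU hU' c => ?_⟩
  have hF := hfacts x ((le_max_left _ _).trans hMx)
  have hθ : 0 ≤ (geo9Y x).M * α₀ := mul_nonneg (hM.le.trans hMM) hα.le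
  -- print's `O(1)Mα₀ ≤ 1`
  have hC0 : 0 ≤ cJ * ((geo9Y x).M * α₀) := mul_nonneg hcJ hθ
  have hC1 : cJ * ((geo9Y x).M * α₀) ≤ 1 := (mul_le_mul_of_nonneg_left ha hcJ).trans ha1
  -- p. 398 transfer of `(Lʲη)⁻³` at constant `L³ ≤ (ℓ+1)³`
  have hL1 : 1 ≤ (geo9Y x).L := hF.one_le_L
  have hLle : (geo9Y x).L ^ |(-3 : ℝ)| ≤ ((θ.ℓ₆ + 1 : ℕ) : ℝ) ^ 3 := by
    rw [show |(-3 : ℝ)| = (3 : ℕ) by norm_num, Real.rpow_natCast]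
    exact pow_le_pow_left₀ (zero_le_one.trans hL1) hF.L_le 3
  have htr : ∀ y y' : (geo9Y x).Site, Real.exp (-(q.αF * ((1 - 2 * q.α) * q.δ₀) * (geo9Y x).dist y y')) * ((geo9Y x).len y' ^ 3)⁻¹ ≤
      ((θ.ℓ₆ + 1 : ℕ) : ℝ) ^ 3 * ((geo9Y x).len y ^ 3)⁻¹ := by
    intro y y'
    have hst := scaleTransfer_len_rpow hF (-3) (by norm_num) y y'
    have hy := geo9Y_len_pos x y
    have hy' := geo9Y_len_pos x y'
    have e1 : ((geo9Y x).len y' ^ 3)⁻¹ = (geo9Y x).len y' ^ (-3 : ℝ) := by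
      rw [show (-3 : ℝ) = -((3 : ℕ) : ℝ) by norm_num, Real.rpow_neg hy'.le, Real.rpow_natCast]
    have e2 : ((geo9Y x).len y ^ 3)⁻¹ = (geo9Y x).len y ^ (-3 : ℝ) := by
      rw [show (-3 : ℝ) = -((3 : ℕ) : ℝ) by norm_num, Real.rpow_neg hy.le, Real.rpow_natCast]
    rw [e1, e2]
    exact hst.trans (mul_le_mul_of_nonneg_right hLle (Real.rpow_nonneg hy.le _))
  -- [4] (2.61) row sum at the rate ρ_R
  have hR : ∑ y' : (geo9Y x).Site, Real.exp (-(ρR * (geo9Y x).dist c y')) ≤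
      rowConst261 (geo9Y (d := θ.d₆) (ℓ := θ.ℓ₆) (hd := θ.hd') (hL := θ.hL') (b₀ := θ.b₀) (b₁ := θ.b₁) (Mstar := Mstar)) ρR := by
    exact hrowc x ((le_max_right _ _).trans hMx) c
  obtain ⟨hT, hK'⟩ := hHT x hMM α₀ hα ha U hU hU'
  -- the column-block letter from the WEIGHTED transpose majorant (F7 §2 `sum_fiber_kernel_le_of_transposePair` at the kernel `B_T·W_T(c)·e^{−δ_T d}`; the weight
  -- is constant in the summation variable), then F7 §5 `norm_trAdjY_JY_le_of_cols_regularAt` at `B_H := (d+1)·#κ·B_T·W_T(c)` — the F7 v1.1 one-call form inlined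
  have hKH0 : ∀ z : FBondY x.toKIdx, 0 ≤ coordBound39 (trBasis N) *
      ∑ k', ‖HDY x.toKIdx (parSymY x.toKIdx) (parBY x.toKIdx) (GpY x.toKIdx (parSymY x.toKIdx)) U (deltaY c (trBasis N k')) z‖ := fun z =>
    mul_nonneg (norm_nonneg _) (Finset.sum_nonneg fun _ _ => norm_nonneg _)
  have hH : ∀ (a : Matrix (Fin N) (Fin N) ℂ) (z : FBondY x.toKIdx),
      ‖HDY x.toKIdx (parSymY x.toKIdx) (parBY x.toKIdx) (GpY x.toKIdx (parSymY x.toKIdx)) U (deltaY c a) z‖ ≤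
        (coordBound39 (trBasis N) *
          ∑ k', ‖HDY x.toKIdx (parSymY x.toKIdx) (parBY x.toKIdx) (GpY x.toKIdx (parSymY x.toKIdx)) U (deltaY c (trBasis N k')) z‖) * ‖a‖ :=
    fun a z => norm_apply_deltaY_le_sum_basis x.toKIdx (trBasis N)
      (HDY x.toKIdx (parSymY x.toKIdx) (parBY x.toKIdx) (GpY x.toKIdx (parSymY x.toKIdx))) U a c z
  have hmain := norm_trAdjY_JY_le_of_cols_regularAt x.toKIdx (g := geo9Y x)
    (HDY x.toKIdx (parSymY x.toKIdx) (parBY x.toKIdx) (GpY x.toKIdx (parSymY x.toKIdx)) U) (bI x) (hbI0 x) (fun c => c) (etaBY_le_len x)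
    hC0 hC1 U (hreg x hMM α₀ hα ha U hU hU') c (BH := ((θ.d₆ : ℝ) + 1) * Fintype.card (TrIdx N) * BT * WT x c) (δH := δT) hKH0
    (mul_nonneg (mul_nonneg (mul_nonneg (by positivity) (Nat.cast_nonneg _)) hBT) (hWT x c)) hH
    (fun y' => by
      -- the column-block letter from the WEIGHTED transpose majorant: F7 §2 at the kernel `B_T·W_T(c)·e^{−δ_T d}` (the weight is constant in the
      -- summation variable), constant reduced by `colConst_eq` — the F7 v1.1 one-call form, inlined
      have h := sum_fiber_kernel_le_of_transposePair (R₀ := 1) (H₀ := H x) x.toKIdx (trBasis N)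
        (bg9Y (Matrix (Fin N) (Fin N) ℂ) (specialUnitaryUnits (Fin N)) x) (fun U => U)
        (HDY x.toKIdx (parSymY x.toKIdx) (parBY x.toKIdx) (GpY x.toKIdx (parSymY x.toKIdx))) (g := geo9Y x) (bI x) (fun c => c) U hc0 hT
        (fun a _ => mul_nonneg (mul_nonneg hBT (hWT x a)) (Real.exp_nonneg _)) hK' c y'
      rw [colConst_eq (trBasis N) hc0] at h
      refine h.trans (le_of_eq ?_)
      ring)
    (by positivity) hδT (geo9K_dist_nonneg x.toKIdx) htr hR
  have hw : 0 ≤ WT x c * ((geo9Y x).len c ^ 3)⁻¹ := mul_nonneg (hWT x c) (inv_nonneg.mpr (pow_nonneg (geo9Y_len_pos x c).le 3))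
  calc _ ≤ _ := hmain
    _ = (N * basisBound39 (trBasis N) ^ 2 * (10 ^ 4 * ((θ.d₆ : ℝ) + 1) * cJ) * (((θ.d₆ : ℝ) + 1) * Fintype.card (TrIdx N) * BT) *
          ((((θ.ℓ₆ + 1 : ℕ) : ℝ) ^ 3) *
            rowConst261 (geo9Y (d := θ.d₆) (ℓ := θ.ℓ₆) (hd := θ.hd') (hL := θ.hL') (b₀ := θ.b₀) (b₁ := θ.b₁) (Mstar := Mstar)) ρR)) *
          ((geo9Y x).M * α₀) * (WT x c * ((geo9Y x).len c ^ 3)⁻¹) := by ring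
    _ ≤ tHJ * ((geo9Y x).M * α₀) * (WT x c * ((geo9Y x).len c ^ 3)⁻¹) := mul_le_mul_of_nonneg_right (mul_le_mul_of_nonneg_right htHJ hθ) hw

/-- ★★ **EDITION 30's `hD2sup` FROM THE WEIGHTED TRANSPOSE LETTER** (`w_H = W_T·(Lʲη)⁻³`, product condition `w_C·W_T·(Lʲη)⁻³ ≦ (Lʲη)⁻²`).
Original docstring of the `W_T ≡ 1` form: F6's `hD2sup_of_form_schemas_w` at the weight split
`w_H = (Lʲη)⁻³`, `w_C` free with `w_C(c)·(Lʲη)_c⁻³ ≦ (Lʲη)_c⁻²`, its binder `hHJ` supplied by `hHJ_of_transpose_schemas`: from [5] (149) (`hC2`), the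
transpose-majorant letter `hHT`, regularity at every fine bond `hreg`, the pins `hbI0 ∕ hblk12`, the member facts and two displayed constants.
[cite: Balaban1985BackgroundPropagators, (3.136)–(3.137) pp.422–423, (3.134) p.422, (3.133) p.422, (3.36) p.396, p.398; Balaban1985Averaging, (149) p.40; Balaban1984PropagatorsII, (2.51) p.232, (2.54), (2.60)–(2.61) pp.233–234] -/
theorem hD2sup_of_transpose_schemas_wR (q : PinPrims) (hq : q.OK) (H : MemberY θ.d₆ θ.ℓ₆ θ.hd' θ.hL' θ.b₀ θ.b₁ Mstar → Prop) (𝔠 : C2Y N θ Mstar)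
    (R₁ R₂ : RegFamY θ.d₆ θ.ℓ₆ θ.hd' θ.hL' θ.b₀ θ.b₁ Mstar (Matrix (Fin N) (Fin N) ℂ)) (c : ℝ)
    (𝔬12 : ∀ x : MemberY θ.d₆ θ.ℓ₆ θ.hd' θ.hL' θ.b₀ θ.b₁ Mstar, B9Thm312Whole.Ops (geo9Y x) (bg9Y (Matrix (Fin N) (Fin N) ℂ) (specialUnitaryUnits (Fin N)) x)
      (XBK (TrIdx N) x.toKIdx) (XBK (TrIdx N) x.toKIdx) (XHK (TrIdx N) x.toKIdx) (XSK (TrIdx N) x.toKIdx))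
    (bI : ∀ x : MemberY θ.d₆ θ.ℓ₆ θ.hd' θ.hL' θ.b₀ θ.b₁ Mstar, FBondY x.toKIdx → IBondY x.toKIdx)
    (hbI0 : ∀ (x : MemberY θ.d₆ θ.ℓ₆ θ.hd' θ.hL' θ.b₀ θ.b₁ Mstar) (f : FBondY x.toKIdx), bI x f = bI x ⟨f.src, 0⟩)
    (hblk12 : ∀ x : MemberY θ.d₆ θ.ℓ₆ θ.hd' θ.hL' θ.b₀ θ.b₁ Mstar, (𝔬12 x).blk = blkBK x.toKIdx (bI x))
    (𝔗 : ∀ x : MemberY θ.d₆ θ.ℓ₆ θ.hd' θ.hL' θ.b₀ θ.b₁ Mstar, (bg9Y (Matrix (Fin N) (Fin N) ℂ) (specialUnitaryUnits (Fin N)) x).Cfg →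
      (XBK (TrIdx N) x.toKIdx → ℝ) →ₗ[ℝ] (XHK (TrIdx N) x.toKIdx → ℝ))
    (WT : ∀ x : MemberY θ.d₆ θ.ℓ₆ θ.hd' θ.hL' θ.b₀ θ.b₁ Mstar, IBondY x.toKIdx → ℝ) (hWT : ∀ x c, 0 ≤ WT x c)
    (wC : ∀ x : MemberY θ.d₆ θ.ℓ₆ θ.hd' θ.hL' θ.b₀ θ.b₁ Mstar, IBondY x.toKIdx → ℝ) (hwC : ∀ x c, 0 ≤ wC x c)
    (hww : ∀ x c, wC x c * (WT x c * ((geo9Y x).len c ^ 3)⁻¹) ≤ ((geo9Y x).len c ^ 2)⁻¹)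
    (κC δC cJ BT δT ρR tHJ δ₂ θ₂ M a : ℝ) (hκC : 0 ≤ κC) (hcJ : 0 ≤ cJ) (hBT : 0 ≤ BT) (hρR : 0 < ρR) (hδ₂ : 0 ≤ δ₂) (hM : 0 < M) (ha1 : cJ * a ≤ 1)
    (hδC : δ₂ + q.αF * ((1 - 2 * q.α) * q.δ₀) + ρR ≤ δC) (hδT : q.αF * ((1 - 2 * q.α) * q.δ₀) + ρR ≤ δT)
    (htHJ : N * basisBound39 (trBasis N) ^ 2 * (10 ^ 4 * ((θ.d₆ : ℝ) + 1) * cJ) * (((θ.d₆ : ℝ) + 1) * Fintype.card (TrIdx N) * BT) *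
      ((((θ.ℓ₆ + 1 : ℕ) : ℝ) ^ 3) * rowConst261 (geo9Y (d := θ.d₆) (ℓ := θ.ℓ₆) (hd := θ.hd') (hL := θ.hL') (b₀ := θ.b₀) (b₁ := θ.b₁) (Mstar := Mstar)) ρR) ≤ tHJ)
    (hθ₂ : (cR39 (trBasis N))⁻¹ * (2 * N * basisBound39 (trBasis N) ^ 2 * κC * tHJ * (((θ.ℓ₆ + 1 : ℕ) : ℝ) ^ 2) *
      rowConst261 (geo9Y (d := θ.d₆) (ℓ := θ.ℓ₆) (hd := θ.hd') (hL := θ.hL') (b₀ := θ.b₀) (b₁ := θ.b₁) (Mstar := Mstar)) ρR) ≤ θ₂)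
    (hC2 : ∀ x : MemberY θ.d₆ θ.ℓ₆ θ.hd' θ.hL' θ.b₀ θ.b₁ Mstar, M ≤ (geo9Y x).M → ∀ α₀ : ℝ, 0 < α₀ → (geo9Y x).M * α₀ ≤ a →
      ∀ U : (bg9Y (Matrix (Fin N) (Fin N) ℂ) (specialUnitaryUnits (Fin N)) x).Cfg,
        (bg9YR (Matrix (Fin N) (Fin N) ℂ) (specialUnitaryUnits (Fin N)) R₁ R₂ x).Reg335 c α₀ U →
        (bg9YR (Matrix (Fin N) (Fin N) ℂ) (specialUnitaryUnits (Fin N)) R₁ R₂ x).Reg336 c α₀ U →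
          C2FormMaj x.toKIdx (g := geo9Y x) (bI x) (fun c => c) (𝔠 x).form U κC δC (wC x))
    (hHT : ∀ x : MemberY θ.d₆ θ.ℓ₆ θ.hd' θ.hL' θ.b₀ θ.b₁ Mstar, M ≤ (geo9Y x).M → ∀ α₀ : ℝ, 0 < α₀ → (geo9Y x).M * α₀ ≤ a →
      ∀ U : (bg9Y (Matrix (Fin N) (Fin N) ℂ) (specialUnitaryUnits (Fin N)) x).Cfg,
        (bg9YR (Matrix (Fin N) (Fin N) ℂ) (specialUnitaryUnits (Fin N)) R₁ R₂ x).Reg335 c α₀ U →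
        (bg9YR (Matrix (Fin N) (Fin N) ℂ) (specialUnitaryUnits (Fin N)) R₁ R₂ x).Reg336 c α₀ U →
          IsTransposePair (HcoK x.toKIdx (trBasis N) (bg9Y (Matrix (Fin N) (Fin N) ℂ) (specialUnitaryUnits (Fin N)) x) (fun U => U)
              (HDY x.toKIdx (parSymY x.toKIdx) (parBY x.toKIdx) (GpY x.toKIdx (parSymY x.toKIdx))) U) (𝔗 x U) ∧
            HasMajorantHom (g := toB6 (geo9Y x) 1 (H x)) (fun p : XBK (TrIdx N) x.toKIdx => bI x p.1) (fun p : XHK (TrIdx N) x.toKIdx => p.1) (𝔗 x U)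
              (fun c y' => BT * WT x c * Real.exp (-(δT * (geo9Y x).dist c y'))))
    (hreg : ∀ x : MemberY θ.d₆ θ.ℓ₆ θ.hd' θ.hL' θ.b₀ θ.b₁ Mstar, M ≤ (geo9Y x).M → ∀ α₀ : ℝ, 0 < α₀ → (geo9Y x).M * α₀ ≤ a →
      ∀ U : (bg9Y (Matrix (Fin N) (Fin N) ℂ) (specialUnitaryUnits (Fin N)) x).Cfg,
        (bg9YR (Matrix (Fin N) (Fin N) ℂ) (specialUnitaryUnits (Fin N)) R₁ R₂ x).Reg335 c α₀ U →
        (bg9YR (Matrix (Fin N) (Fin N) ℂ) (specialUnitaryUnits (Fin N)) R₁ R₂ x).Reg336 c α₀ U →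
          ∀ μ s, RegularAt (shiftsV1 (PV θ.d₆ θ.ℓ₆ x.toKIdx.m x.toKIdx.K θ.hd' θ.hL')) U (etaBY x.toKIdx)
            (cJ * ((geo9Y x).M * α₀)) ((geo9Y x).len (bI x ⟨s, 0⟩)) μ s) :
    ∃ ML : ℝ, ∀ x : MemberY θ.d₆ θ.ℓ₆ θ.hd' θ.hL' θ.b₀ θ.b₁ Mstar, ML ≤ (geo9Y x).M → M ≤ (geo9Y x).M → ∀ α₀ : ℝ, 0 < α₀ → (geo9Y x).M * α₀ ≤ a →
      ∀ U : (bg9Y (Matrix (Fin N) (Fin N) ℂ) (specialUnitaryUnits (Fin N)) x).Cfg,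
        (bg9YR (Matrix (Fin N) (Fin N) ℂ) (specialUnitaryUnits (Fin N)) R₁ R₂ x).Reg335 c α₀ U →
        (bg9YR (Matrix (Fin N) (Fin N) ℂ) (specialUnitaryUnits (Fin N)) R₁ R₂ x).Reg336 c α₀ U →
          HasMajorant (g := toB6 (geo9Y x) 1 (H x)) (𝔬12 x).blk
            (D2coK x.toKIdx (trBasis N) (bg9Y (Matrix (Fin N) (Fin N) ℂ) (specialUnitaryUnits (Fin N)) x) (fun U => U) ((resYOfC2 N θ Mstar 𝔠 x).Δ2) U)
            (fun (a b : (geo9Y x).Site) => θ₂ * ((geo9Y x).M * α₀) * ((geo9Y x).len a ^ 2)⁻¹ * Real.exp (-(δ₂ * (geo9Y x).dist a b))) := by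
  obtain ⟨MH, hHJ⟩ := hHJ_of_transpose_schemas_wR q hq H R₁ R₂ c bI hbI0 𝔗 WT hWT cJ BT δT ρR tHJ M a hcJ hBT hρR hM ha1 hδT htHJ hHT hreg
  -- F6 in the regime `max M MH ≤ M_x`
  have hrc : 0 ≤ rowConst261 (geo9Y (d := θ.d₆) (ℓ := θ.ℓ₆) (hd := θ.hd') (hL := θ.hL') (b₀ := θ.b₀) (b₁ := θ.b₁) (Mstar := Mstar)) ρR :=
    rowConst261_nonneg _ _
  have htHJ0 : 0 ≤ tHJ := le_trans (by positivity) htHJ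
  have hM' : 0 < max M MH := lt_max_of_lt_left hM
  obtain ⟨ML, hsup⟩ := hD2sup_of_form_schemas_wR q hq H 𝔠 R₁ R₂ c 𝔬12 bI hblk12 wC (fun x c => WT x c * ((geo9Y x).len c ^ 3)⁻¹) hwC
    (fun x c => mul_nonneg (hWT x c) (inv_nonneg.mpr (pow_nonneg (geo9Y_len_pos x c).le 3))) hww κC δC tHJ ρR δ₂ θ₂ (max M MH) a hκC htHJ0 hρR hδ₂ hM' hδC hθ₂
    (fun x hMx α₀ hα ha U hU hU' => hC2 x ((le_max_left _ _).trans hMx) α₀ hα ha U hU hU')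
    (fun x hMx α₀ hα ha U hU hU' c => hHJ x ((le_max_right _ _).trans hMx) ((le_max_left _ _).trans hMx) α₀ hα ha U hU hU' c)
  exact ⟨max ML MH, fun x hMx hMM α₀ hα ha U hU hU' =>
    hsup x ((le_max_left _ _).trans hMx) (max_le hMM ((le_max_right _ _).trans hMx)) α₀ hα ha U hU hU'⟩

/-- ★★ **EDITION 29's `hD2L2` FROM THE WEIGHTED TRANSPOSE LETTER** (`w_H = W_T·(Lʲη)⁻³`).  Original docstring of the `W_T ≡ 1` form: `hD2sup_of_transpose_schemas` + def-Y's reality letters `hC hH`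
(F6's `hD2L2_of_form_schemas_w` road: `resYOfC2_Δ2_isSymmTr` + Schur `blockBd_d2coK_of_sup_symm`).
[cite: Balaban1985BackgroundPropagators, (3.137) p.423, (3.134) p.422, (3.46) p.398, p.391; Balaban1985Averaging, (149) p.40; Balaban1984PropagatorsII, (2.51) p.232] -/
theorem hD2L2_of_transpose_schemas_wR (q : PinPrims) (hq : q.OK) (H : MemberY θ.d₆ θ.ℓ₆ θ.hd' θ.hL' θ.b₀ θ.b₁ Mstar → Prop) (𝔠 : C2Y N θ Mstar)
    (R₁ R₂ : RegFamY θ.d₆ θ.ℓ₆ θ.hd' θ.hL' θ.b₀ θ.b₁ Mstar (Matrix (Fin N) (Fin N) ℂ)) (hG : MemOfFam (specialUnitaryUnits (Fin N)) R₁) (c : ℝ)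
    (𝔬12 : ∀ x : MemberY θ.d₆ θ.ℓ₆ θ.hd' θ.hL' θ.b₀ θ.b₁ Mstar, B9Thm312Whole.Ops (geo9Y x) (bg9Y (Matrix (Fin N) (Fin N) ℂ) (specialUnitaryUnits (Fin N)) x)
      (XBK (TrIdx N) x.toKIdx) (XBK (TrIdx N) x.toKIdx) (XHK (TrIdx N) x.toKIdx) (XSK (TrIdx N) x.toKIdx))
    (bI : ∀ x : MemberY θ.d₆ θ.ℓ₆ θ.hd' θ.hL' θ.b₀ θ.b₁ Mstar, FBondY x.toKIdx → IBondY x.toKIdx)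
    (hbI0 : ∀ (x : MemberY θ.d₆ θ.ℓ₆ θ.hd' θ.hL' θ.b₀ θ.b₁ Mstar) (f : FBondY x.toKIdx), bI x f = bI x ⟨f.src, 0⟩)
    (hblk12 : ∀ x : MemberY θ.d₆ θ.ℓ₆ θ.hd' θ.hL' θ.b₀ θ.b₁ Mstar, (𝔬12 x).blk = blkBK x.toKIdx (bI x))
    (𝔗 : ∀ x : MemberY θ.d₆ θ.ℓ₆ θ.hd' θ.hL' θ.b₀ θ.b₁ Mstar, (bg9Y (Matrix (Fin N) (Fin N) ℂ) (specialUnitaryUnits (Fin N)) x).Cfg →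
      (XBK (TrIdx N) x.toKIdx → ℝ) →ₗ[ℝ] (XHK (TrIdx N) x.toKIdx → ℝ))
    (WT : ∀ x : MemberY θ.d₆ θ.ℓ₆ θ.hd' θ.hL' θ.b₀ θ.b₁ Mstar, IBondY x.toKIdx → ℝ) (hWT : ∀ x c, 0 ≤ WT x c)
    (wC : ∀ x : MemberY θ.d₆ θ.ℓ₆ θ.hd' θ.hL' θ.b₀ θ.b₁ Mstar, IBondY x.toKIdx → ℝ) (hwC : ∀ x c, 0 ≤ wC x c)
    (hww : ∀ x c, wC x c * (WT x c * ((geo9Y x).len c ^ 3)⁻¹) ≤ ((geo9Y x).len c ^ 2)⁻¹)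
    (κC δC cJ BT δT ρR tHJ δ₂ θ₂ M a : ℝ) (hκC : 0 ≤ κC) (hcJ : 0 ≤ cJ) (hBT : 0 ≤ BT) (hρR : 0 < ρR) (hδ₂ : 0 ≤ δ₂) (hθ₂0 : 0 ≤ θ₂) (hM : 0 < M)
    (ha1 : cJ * a ≤ 1) (hδC : δ₂ + q.αF * ((1 - 2 * q.α) * q.δ₀) + ρR ≤ δC) (hδT : q.αF * ((1 - 2 * q.α) * q.δ₀) + ρR ≤ δT)
    (htHJ : N * basisBound39 (trBasis N) ^ 2 * (10 ^ 4 * ((θ.d₆ : ℝ) + 1) * cJ) * (((θ.d₆ : ℝ) + 1) * Fintype.card (TrIdx N) * BT) *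
      ((((θ.ℓ₆ + 1 : ℕ) : ℝ) ^ 3) * rowConst261 (geo9Y (d := θ.d₆) (ℓ := θ.ℓ₆) (hd := θ.hd') (hL := θ.hL') (b₀ := θ.b₀) (b₁ := θ.b₁) (Mstar := Mstar)) ρR) ≤ tHJ)
    (hθ₂ : (cR39 (trBasis N))⁻¹ * (2 * N * basisBound39 (trBasis N) ^ 2 * κC * tHJ * (((θ.ℓ₆ + 1 : ℕ) : ℝ) ^ 2) *
      rowConst261 (geo9Y (d := θ.d₆) (ℓ := θ.ℓ₆) (hd := θ.hd') (hL := θ.hL') (b₀ := θ.b₀) (b₁ := θ.b₁) (Mstar := Mstar)) ρR) ≤ θ₂)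
    (hC2 : ∀ x : MemberY θ.d₆ θ.ℓ₆ θ.hd' θ.hL' θ.b₀ θ.b₁ Mstar, M ≤ (geo9Y x).M → ∀ α₀ : ℝ, 0 < α₀ → (geo9Y x).M * α₀ ≤ a →
      ∀ U : (bg9Y (Matrix (Fin N) (Fin N) ℂ) (specialUnitaryUnits (Fin N)) x).Cfg,
        (bg9YR (Matrix (Fin N) (Fin N) ℂ) (specialUnitaryUnits (Fin N)) R₁ R₂ x).Reg335 c α₀ U →
        (bg9YR (Matrix (Fin N) (Fin N) ℂ) (specialUnitaryUnits (Fin N)) R₁ R₂ x).Reg336 c α₀ U →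
          C2FormMaj x.toKIdx (g := geo9Y x) (bI x) (fun c => c) (𝔠 x).form U κC δC (wC x))
    (hHT : ∀ x : MemberY θ.d₆ θ.ℓ₆ θ.hd' θ.hL' θ.b₀ θ.b₁ Mstar, M ≤ (geo9Y x).M → ∀ α₀ : ℝ, 0 < α₀ → (geo9Y x).M * α₀ ≤ a →
      ∀ U : (bg9Y (Matrix (Fin N) (Fin N) ℂ) (specialUnitaryUnits (Fin N)) x).Cfg,
        (bg9YR (Matrix (Fin N) (Fin N) ℂ) (specialUnitaryUnits (Fin N)) R₁ R₂ x).Reg335 c α₀ U →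
        (bg9YR (Matrix (Fin N) (Fin N) ℂ) (specialUnitaryUnits (Fin N)) R₁ R₂ x).Reg336 c α₀ U →
          IsTransposePair (HcoK x.toKIdx (trBasis N) (bg9Y (Matrix (Fin N) (Fin N) ℂ) (specialUnitaryUnits (Fin N)) x) (fun U => U)
              (HDY x.toKIdx (parSymY x.toKIdx) (parBY x.toKIdx) (GpY x.toKIdx (parSymY x.toKIdx))) U) (𝔗 x U) ∧
            HasMajorantHom (g := toB6 (geo9Y x) 1 (H x)) (fun p : XBK (TrIdx N) x.toKIdx => bI x p.1) (fun p : XHK (TrIdx N) x.toKIdx => p.1) (𝔗 x U)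
              (fun c y' => BT * WT x c * Real.exp (-(δT * (geo9Y x).dist c y'))))
    (hreg : ∀ x : MemberY θ.d₆ θ.ℓ₆ θ.hd' θ.hL' θ.b₀ θ.b₁ Mstar, M ≤ (geo9Y x).M → ∀ α₀ : ℝ, 0 < α₀ → (geo9Y x).M * α₀ ≤ a →
      ∀ U : (bg9Y (Matrix (Fin N) (Fin N) ℂ) (specialUnitaryUnits (Fin N)) x).Cfg,
        (bg9YR (Matrix (Fin N) (Fin N) ℂ) (specialUnitaryUnits (Fin N)) R₁ R₂ x).Reg335 c α₀ U →
        (bg9YR (Matrix (Fin N) (Fin N) ℂ) (specialUnitaryUnits (Fin N)) R₁ R₂ x).Reg336 c α₀ U →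
          ∀ μ s, RegularAt (shiftsV1 (PV θ.d₆ θ.ℓ₆ x.toKIdx.m x.toKIdx.K θ.hd' θ.hL')) U (etaBY x.toKIdx)
            (cJ * ((geo9Y x).M * α₀)) ((geo9Y x).len (bI x ⟨s, 0⟩)) μ s)
    (hC : ∀ (x : MemberY θ.d₆ θ.ℓ₆ θ.hd' θ.hL' θ.b₀ θ.b₁ Mstar) (U : CfgY (Matrix (Fin N) (Fin N) ℂ) x.toKIdx), (∀ μ z, U μ z ∈ specialUnitaryUnits (Fin N)) →
      ∀ A A' : FBondY x.toKIdx → Matrix (Fin N) (Fin N) ℂ, (𝔠 x).form U (star A) (star A') = star ((𝔠 x).form U A A'))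
    (hH : ∀ (x : MemberY θ.d₆ θ.ℓ₆ θ.hd' θ.hL' θ.b₀ θ.b₁ Mstar) (U : CfgY (Matrix (Fin N) (Fin N) ℂ) x.toKIdx), (∀ μ z, U μ z ∈ specialUnitaryUnits (Fin N)) →
      ∀ X : IBondY x.toKIdx → Matrix (Fin N) (Fin N) ℂ,
        HDY x.toKIdx (parSymY x.toKIdx) (parBY x.toKIdx) (GpY x.toKIdx (parSymY x.toKIdx)) U (star X) =
          star (HDY x.toKIdx (parSymY x.toKIdx) (parBY x.toKIdx) (GpY x.toKIdx (parSymY x.toKIdx)) U X)) :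
    ∃ ML : ℝ, ∀ x : MemberY θ.d₆ θ.ℓ₆ θ.hd' θ.hL' θ.b₀ θ.b₁ Mstar, ML ≤ (geo9Y x).M → M ≤ (geo9Y x).M → ∀ α₀ : ℝ, 0 < α₀ → (geo9Y x).M * α₀ ≤ a →
      ∀ U : (bg9Y (Matrix (Fin N) (Fin N) ℂ) (specialUnitaryUnits (Fin N)) x).Cfg,
        (bg9YR (Matrix (Fin N) (Fin N) ℂ) (specialUnitaryUnits (Fin N)) R₁ R₂ x).Reg335 c α₀ U →
        (bg9YR (Matrix (Fin N) (Fin N) ℂ) (specialUnitaryUnits (Fin N)) R₁ R₂ x).Reg336 c α₀ U →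
          BlockBd (g := toB6 (geo9Y x) 1 (H x)) (𝔬12 x).blk (𝔬12 x).blk
            (D2coK x.toKIdx (trBasis N) (bg9Y (Matrix (Fin N) (Fin N) ℂ) (specialUnitaryUnits (Fin N)) x) (fun U => U) ((resYOfC2 N θ Mstar 𝔠 x).Δ2) U)
            (fun (y y' : (geo9Y x).Site) => θ₂ * ((geo9Y x).M * α₀) * ((geo9Y x).len y)⁻¹ * ((geo9Y x).len y')⁻¹ *
              Real.exp (-(δ₂ * (geo9Y x).dist y y'))) := by
  obtain ⟨MH, hHJ⟩ := hHJ_of_transpose_schemas_wR q hq H R₁ R₂ c bI hbI0 𝔗 WT hWT cJ BT δT ρR tHJ M a hcJ hBT hρR hM ha1 hδT htHJ hHT hreg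
  have hrc : 0 ≤ rowConst261 (geo9Y (d := θ.d₆) (ℓ := θ.ℓ₆) (hd := θ.hd') (hL := θ.hL') (b₀ := θ.b₀) (b₁ := θ.b₁) (Mstar := Mstar)) ρR :=
    rowConst261_nonneg _ _
  have htHJ0 : 0 ≤ tHJ := le_trans (by positivity) htHJ
  have hM' : 0 < max M MH := lt_max_of_lt_left hM
  obtain ⟨ML, hL2⟩ := hD2L2_of_form_schemas_wR q hq H 𝔠 R₁ R₂ hG c 𝔬12 bI hblk12 wC (fun x c => WT x c * ((geo9Y x).len c ^ 3)⁻¹) hwC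
    (fun x c => mul_nonneg (hWT x c) (inv_nonneg.mpr (pow_nonneg (geo9Y_len_pos x c).le 3))) hww κC δC tHJ ρR δ₂ θ₂ (max M MH) a hκC htHJ0 hρR hδ₂ hθ₂0 hM' hδC hθ₂
    (fun x hMx α₀ hα ha U hU hU' => hC2 x ((le_max_left _ _).trans hMx) α₀ hα ha U hU hU')
    (fun x hMx α₀ hα ha U hU hU' c => hHJ x ((le_max_right _ _).trans hMx) ((le_max_left _ _).trans hMx) α₀ hα ha U hU hU' c) hC hH
  exact ⟨max ML MH, fun x hMx hMM α₀ hα ha U hU hU' =>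
    hL2 x ((le_max_left _ _).trans hMx) (max_le hMM ((le_max_right _ _).trans hMx)) α₀ hα ha U hU hU'⟩

end Summit.QuantumFields.YangMills.BalabanUVNodes.N06HstarJAtPinsWPhysR

end
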